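import Literature.NumberTheory.Automorphic.LocalPiSchwartzBruhatFourier
import Literature.NumberTheory.Automorphic.LocalFieldHaarBalls
import Literature.NumberTheory.Automorphic.TateSelfDualHaar
import Mathlib.MeasureTheory.Integral.Pi
import Mathlib.MeasureTheory.Integral.Prod
import HarnessLib

/-!
# Slice densities of the linear fibration `y ↦ x ⬝ᵥ y` over a non-archimedean local field
# (the one-sided half of Weil's fibre measures for the SPLIT hermitian form `h(x, y) = x ⬝ᵥ y`; [Weil1965] n° 37, 44, 50)

Topic `NumberTheory/Weil1965`; namespace `Literature.NumberTheory.Weil1965.SplitPlace`. KERNEL mathematics only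
(definitions with bodies + theorems; no named fact, no `axiom`, no `sorry`).  First of two files; the sequel
`SplitPlaceFibreDensity.lean` integrates the slice densities over `x` (Weil's `|θ_b|_v` at a place split in `E/F`).

SETTING. `K` a non-archimedean local field with additive Haar measure `μ`, `ι` a finite index type, `K^ι` with the product
Haar measure `μ^ι = Measure.pi (fun _ => μ)`, boxes `(𝔭^ℓ)^ι = piPrimePowBall K ι ℓ` and balls `𝔭^r = primePowBall K r`
(★ `LocalPiSchwartzBruhatFourier`, `TateLocalFactors`). At a finite place `v` of `F` split in the CM extension `E/F` the
hermitian space is `V_v = F_vᴺ × F_vᴺ` with `h(x, y) = x ⬝ᵥ y` (E-2 lead finding `E2-SW2c-FINDING.v0` §2 (v); census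
`SW2-IDENTITY-CENSUS.v0` §4 I-SPLIT, crux H413): for FIXED `x ≠ 0` the map `y ↦ x ⬝ᵥ y` is a LINEAR FIBRATION of `K^ι`
over `K`, and everything about the fibre measures of `h` at a split place reduces to it.

WHAT IS HERE (all proved).
* §0 LEVELS: every `x ≠ 0` in `K^ι` lies in exactly one box-shell `(𝔭^k)^ι ∖ (𝔭^{k+1})^ι` (its level `k`), and then
  `w ↦ x ⬝ᵥ w` maps `(𝔭^ℓ)^ι` ONTO `𝔭^{ℓ+k}` (`exists_dotProduct_eq_of_mem_shell`).
* §1 THE PLATEAU LEMMA (exactness of coarse averaging along the fibration): for `f` on `K^ι` integrable and invariant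
  under `(𝔭^ℓ)^ι`, `x` of level `k` and `r ≥ ℓ + k`,
  `μ(𝔭^r)⁻¹ ∫ 𝟙_{b+𝔭^r}(x ⬝ᵥ y) f(y) dy = μ(𝔭^{ℓ+k})⁻¹ ∫ 𝟙_{b+𝔭^{ℓ+k}}(x ⬝ᵥ y) f(y) dy` (`sliceIntegral_plateau`;
  translation invariance + Fubini over the base `K`; no counting of cosets).
* §2 THE SLICE DENSITY `sliceDensity μ x f b` (density at `b`, w.r.t. `μ`, of the image of `f dμ^ι` under `y ↦ x ⬝ᵥ y`):
  the limit of the slab averages = the plateau value (`tendsto_sliceAvg`, `sliceDensity_eq`); locally constant in `b`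
  (`sliceDensity_eq_of_mem_vadd`); bounded by `μ(𝔭^{ℓ+k})⁻¹ ∫ |f|` uniformly in the radius (`norm_sliceAvg_le`).
* §3 THE LEVEL WEIGHT `levelWeight μ ℓ x = μ(𝔭^{ℓ + level x})⁻¹` — the uniform bound of §2 as a function of `x` — is
  INTEGRABLE on every box of `K^ι` when `2 ≤ |ι|` (`integrableOn_levelWeight`: the shell of level `k` has measure
  `≍ q^{-k|ι|}` and weight `≍ q^k`, a geometric series convergent iff `|ι| ≥ 2`). This is the integrability of `‖x‖⁻¹`
  near the origin of `K^ι`, i.e. Weil's condition for the CONTINUITY AT `0` of the singular fibre integral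
  [Weil1965, Chap. III n° 37 Prop. 6] at a split place (`m = |ι| ≥ 2`; at a split place already `N ≥ 2` suffices).

## References

* [Weil1965] A. Weil, *Sur la formule de Siegel dans la théorie des groupes classiques*, Acta Math. 113 (1965) 1–87:
  Chap. III n° 37 Prop. 6 p. 54, Chap. IV n° 44 Thm 2 p. 63, Chap. V n° 48–49 Lemmas 21–22 pp. 68–70, n° 50 (40) p. 74.
* [WeilBNT1967] A. Weil, *Basic Number Theory* (1967), Ch. I §2 (modules), Ch. II §2 and §5 (boxes, the pairing).
-/

noncomputable section

namespace Literature.NumberTheory.Weil1965.SplitPlace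

open _root_.MeasureTheory _root_.Filter _root_.Set Literature.NumberTheory.Automorphic
open Literature.NumberTheory.Automorphic.LocalFieldHaar
open scoped Topology Pointwise NNReal ENNReal
open Literature.NumberTheory.GaloisRepresentations.IsNonarchimedeanLocalField

variable {K : Type*} [Field K] [ValuativeRel K] [TopologicalSpace K] [IsNonarchimedeanLocalField K]
variable {ι : Type*}

/-! ## §0 Levels in `K^ι` and the surjectivity of `w ↦ x ⬝ᵥ w` on boxes -/

section Level

/-- a point of a box-shell `(𝔭^k)^ι ∖ (𝔭^{k+1})^ι` has a coordinate of exact absolute value `(q⁻¹)^k`.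
[cite: WeilBNT1967, Ch. II §2, Def. 2] -/
theorem exists_normAbs_apply_eq_of_mem_shell {k : ℤ} {x : ι → K}
    (hx : x ∈ piPrimePowBall K ι k \ piPrimePowBall K ι (k + 1)) :
    ∃ i, normAbs K (x i) = ((residueFieldCard K : ℝ≥0)⁻¹) ^ k := by
  obtain ⟨hxk, hxk1⟩ := hx
  rw [mem_piPrimePowBall_iff] at hxk hxk1
  push Not at hxk1
  obtain ⟨i, hi⟩ := hxk1
  exact ⟨i, mem_shell_iff.1 ⟨hxk i, hi⟩⟩

/-- every non-zero `x ∈ K^ι` lies in some box-shell `(𝔭^k)^ι ∖ (𝔭^{k+1})^ι` (its LEVEL `k`: `maxᵢ ‖xᵢ‖ = (q⁻¹)^k`).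
[cite: WeilBNT1967, Ch. II §2, Def. 2] -/
theorem exists_mem_shell_of_ne_zero [Fintype ι] [Nonempty ι] {x : ι → K} (hx : x ≠ 0) :
    ∃ k : ℤ, x ∈ piPrimePowBall K ι k \ piPrimePowBall K ι (k + 1) := by
  classical
  -- exponents of the non-zero coordinates
  have hcoord : ∀ i, ∃ k : ℤ, x i ≠ 0 → normAbs K (x i) = ((residueFieldCard K : ℝ≥0)⁻¹) ^ k := by
    intro i
    by_cases h : x i = 0
    · exact ⟨0, fun h' => (h' h).elim⟩
    · obtain ⟨k, hk⟩ := exists_normAbs_eq_inv_zpow h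
      exact ⟨k, fun _ => hk⟩
  choose e he using hcoord
  obtain ⟨i₀, hi₀⟩ : ∃ i, x i ≠ 0 := by
    by_contra h
    push Not at h
    exact hx (funext h)
  -- the minimal exponent among the non-zero coordinates
  set S : Finset ι := Finset.univ.filter fun i => x i ≠ 0 with hS
  have hSne : S.Nonempty := ⟨i₀, by simp [hS, hi₀]⟩
  set k : ℤ := S.inf' hSne e with hk
  refine ⟨k, ?_, ?_⟩
  · rw [mem_piPrimePowBall_iff]
    intro i
    rw [mem_primePowBall_iff]
    by_cases h : x i = 0
    · rw [h, map_zero]; exact zero_le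
    · rw [he i h]
      exact zpow_le_zpow_right_of_le_one₀ inv_residueFieldCard_pos inv_residueFieldCard_lt_one.le
        (Finset.inf'_le _ (by simp [hS, h]))
  · obtain ⟨j, hjS, hj⟩ := Finset.exists_mem_eq_inf' hSne e
    have hxj : x j ≠ 0 := by simpa [hS] using hjS
    intro hmem
    have h1 : normAbs K (x j) ≤ ((residueFieldCard K : ℝ≥0)⁻¹) ^ (k + 1) := mem_piPrimePowBall_iff.1 hmem j
    rw [he j hxj, ← hj] at h1
    exact absurd h1 (not_le.2 (inv_zpow_succ_lt _))

/-- the shells are disjoint: the level of `x` is unique. [cite: WeilBNT1967, Ch. II §2, Def. 2] -/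
theorem eq_of_mem_shell_of_mem_shell {k k' : ℤ} {x : ι → K}
    (hx : x ∈ piPrimePowBall K ι k \ piPrimePowBall K ι (k + 1))
    (hx' : x ∈ piPrimePowBall K ι k' \ piPrimePowBall K ι (k' + 1)) : k = k' := by
  by_contra hne
  rcases lt_or_gt_of_ne hne with h | h
  · exact hx.2 (piPrimePowBall_antitone (by omega) hx'.1)
  · exact hx'.2 (piPrimePowBall_antitone (by omega) hx.1)

/-- `x ⬝ᵥ w ∈ 𝔭^{ℓ+k}` for `x ∈ (𝔭^k)^ι`, `w ∈ (𝔭^ℓ)^ι`. [cite: WeilBNT1967, Ch. II §5, Prop. 12] -/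
theorem dotProduct_mem_primePowBall_of_mem [Fintype ι] {k ℓ : ℤ} {x w : ι → K} (hx : x ∈ piPrimePowBall K ι k)
    (hw : w ∈ piPrimePowBall K ι ℓ) : x ⬝ᵥ w ∈ primePowBall K (ℓ + k) := by
  rw [add_comm]
  exact dotProduct_mem_primePowBall hx hw

/-- **surjectivity of the linear fibration**: for `x` of level `k`, `w ↦ x ⬝ᵥ w` maps the box `(𝔭^ℓ)^ι` ONTO `𝔭^{ℓ+k}`
(hit `t` with `w = (t / x_{i₀}) e_{i₀}`, `‖x_{i₀}‖ = (q⁻¹)^k`). [cite: WeilBNT1967, Ch. II §5, Prop. 12] -/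
theorem exists_dotProduct_eq_of_mem_shell [Fintype ι] [DecidableEq ι] {k ℓ : ℤ} {x : ι → K}
    (hx : x ∈ piPrimePowBall K ι k \ piPrimePowBall K ι (k + 1)) {t : K} (ht : t ∈ primePowBall K (ℓ + k)) :
    ∃ w ∈ piPrimePowBall K ι ℓ, x ⬝ᵥ w = t := by
  obtain ⟨i₀, hi₀⟩ := exists_normAbs_apply_eq_of_mem_shell hx
  have hx0 : x i₀ ≠ 0 := by
    intro h
    rw [h, map_zero] at hi₀
    exact (zpow_pos inv_residueFieldCard_pos k).ne hi₀
  refine ⟨Pi.single i₀ (t / x i₀), single_mem_piPrimePowBall i₀ ?_, ?_⟩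
  · rw [div_eq_mul_inv, mul_comm, mul_mem_primePowBall_iff (k := -k) (by rw [map_inv₀, hi₀, zpow_neg])]
    simpa using ht
  · rw [dotProduct_single, mul_div_cancel₀ _ hx0]

end Level

/-! ## §1 Slabs and the plateau lemma along the linear fibration `y ↦ x ⬝ᵥ y` -/

section OneDim

/-- for `r ≥ m`: a coset `c + 𝔭^r` through a point of `b + 𝔭^m` lies inside it. [cite: Weil1965, Chap. V n° 49 Lemma 22, p. 70] -/
theorem vadd_primePowBall_subset_of_mem {m r : ℤ} (hr : m ≤ r) {b c : K} (hc : c ∈ b +ᵥ primePowBall K m) :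
    c +ᵥ primePowBall K r ⊆ b +ᵥ primePowBall K m := by
  intro z hz
  rw [mem_vadd_primePowBall_iff] at hc hz ⊢
  have e : z - b = (z - c) + (c - b) := by ring
  rw [e]
  exact add_mem_primePowBall (primePowBall_antitone hr hz) hc

/-- for `r ≥ m`: a coset `c + 𝔭^r` through a point OUTSIDE `b + 𝔭^m` is disjoint from it. [cite: Weil1965, Chap. V n° 49 Lemma 22, p. 70] -/
theorem disjoint_vadd_primePowBall_of_notMem {m r : ℤ} (hr : m ≤ r) {b c : K} (hc : c ∉ b +ᵥ primePowBall K m) :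
    Disjoint (b +ᵥ primePowBall K m) (c +ᵥ primePowBall K r) := by
  rw [Set.disjoint_left]
  intro z hz hz'
  apply hc
  rw [mem_vadd_primePowBall_iff] at hz hz' ⊢
  have e : c - b = (z - b) + -(z - c) := by ring
  rw [e]
  exact add_mem_primePowBall hz (neg_mem_primePowBall (primePowBall_antitone hr hz'))

/-- membership swap: `c ∈ b' + 𝔭^r ↔ b' ∈ c + 𝔭^r`. [cite: Weil1965, Chap. V n° 49 Lemma 22, p. 70] -/
theorem mem_vadd_primePowBall_comm {r : ℤ} {b' c : K} :
    c ∈ b' +ᵥ primePowBall K r ↔ b' ∈ c +ᵥ primePowBall K r := by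
  rw [mem_vadd_primePowBall_iff, mem_vadd_primePowBall_iff]
  constructor <;> intro h <;> simpa using neg_mem_primePowBall h

variable [MeasurableSpace K] [BorelSpace K] (μ : Measure K) [μ.IsAddHaarMeasure]

/-- **the base integral**: `∫ 𝟙_{b+𝔭^m}(b') 𝟙_{b'+𝔭^r}(c) dμ(b') = μ(𝔭^r) · 𝟙_{b+𝔭^m}(c)` for `r ≥ m` (the coset
`c + 𝔭^r` is inside `b + 𝔭^m` or disjoint from it). [cite: Weil1965, Chap. V n° 49 Lemma 22, p. 70] -/
theorem integral_indicator_mul_indicator_vadd {m r : ℤ} (hr : m ≤ r) (b c : K) :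
    ∫ b', (b +ᵥ primePowBall K m).indicator (1 : K → ℂ) b' * (b' +ᵥ primePowBall K r).indicator (1 : K → ℂ) c ∂μ =
      (μ.real (primePowBall K r) : ℂ) * (b +ᵥ primePowBall K m).indicator (1 : K → ℂ) c := by
  have hmeas : MeasurableSet ((b +ᵥ primePowBall K m) ∩ (c +ᵥ primePowBall K r)) :=
    (measurableSet_vadd_primePowBall m b).inter (measurableSet_vadd_primePowBall r c)
  have key : (fun b' => (b +ᵥ primePowBall K m).indicator (1 : K → ℂ) b' *
      (b' +ᵥ primePowBall K r).indicator (1 : K → ℂ) c) =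
      ((b +ᵥ primePowBall K m) ∩ (c +ᵥ primePowBall K r)).indicator (fun _ => (1 : ℂ)) := by
    funext b'
    by_cases h1 : b' ∈ b +ᵥ primePowBall K m
    · by_cases h2 : c ∈ b' +ᵥ primePowBall K r
      · rw [Set.indicator_of_mem h1, Set.indicator_of_mem h2,
          Set.indicator_of_mem (Set.mem_inter h1 (mem_vadd_primePowBall_comm.1 h2))]
        simp
      · have h2' : b' ∉ (b +ᵥ primePowBall K m) ∩ (c +ᵥ primePowBall K r) := fun h =>
          h2 (mem_vadd_primePowBall_comm.2 h.2)
        rw [Set.indicator_of_notMem h2, Set.indicator_of_notMem h2', mul_zero]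
    · have h1' : b' ∉ (b +ᵥ primePowBall K m) ∩ (c +ᵥ primePowBall K r) := fun h => h1 h.1
      rw [Set.indicator_of_notMem h1, Set.indicator_of_notMem h1', zero_mul]
  rw [key, integral_indicator_const _ hmeas, Complex.real_smul, mul_one]
  by_cases hc : c ∈ b +ᵥ primePowBall K m
  · rw [Set.inter_eq_right.2 (vadd_primePowBall_subset_of_mem hr hc), Set.indicator_of_mem hc, Pi.one_apply,
      mul_one, measureReal_def, measureReal_def, measure_vadd]
  · rw [(disjoint_vadd_primePowBall_of_notMem hr hc).inter_eq, Set.indicator_of_notMem hc, mul_zero,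
      measureReal_empty, Complex.ofReal_zero]

end OneDim

/-! ## §1b The slab integrals `S_r(x, f; b) = ∫ 𝟙_{b+𝔭^r}(x ⬝ᵥ y) f(y) dμ^ι(y)` and the plateau lemma -/

section Slab

variable [Fintype ι] [MeasurableSpace K] [BorelSpace K] (μ : Measure K) [μ.IsAddHaarMeasure]

omit [Fintype ι] [MeasurableSpace K] [BorelSpace K] in
/-- instance helper: `K` is second countable. [folklore] -/
private theorem secondCountable : SecondCountableTopology K := secondCountableTopology_localField K

omit [Fintype ι] [MeasurableSpace K] [BorelSpace K] in
/-- instance helper: `K` is Hausdorff. [folklore] -/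
private theorem t2 : T2Space K :=
  (Literature.NumberTheory.GaloisRepresentations.IsNonarchimedeanLocalField.isLocalField K).toT2Space

omit [Fintype ι] [BorelSpace K] in
/-- instance helper: a Haar measure on `K` is `σ`-finite. [folklore] -/
private theorem sigmaFinite_haar : SigmaFinite μ := by
  haveI : T2Space K := t2
  haveI : LocallyCompactSpace K :=
    (Literature.NumberTheory.GaloisRepresentations.IsNonarchimedeanLocalField.isLocalField K).toLocallyCompactSpace
  haveI : SecondCountableTopology K := secondCountable
  infer_instance

/-- **the slab integral** `S_r(x, f; b) = ∫_{K^ι} 𝟙_{b+𝔭^r}(x ⬝ᵥ y) f(y) dμ^ι(y)` — the mass of `f dy` on the slab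
`{y | x ⬝ᵥ y ∈ b + 𝔭^r}` of the linear fibration `y ↦ x ⬝ᵥ y`. [cite: Weil1965, Chap. IV n° 44 Thm 2, p. 63] -/
def sliceIntegral (x : ι → K) (f : (ι → K) → ℂ) (b : K) (r : ℤ) : ℂ :=
  ∫ y, (b +ᵥ primePowBall K r).indicator (1 : K → ℂ) (x ⬝ᵥ y) * f y ∂(Measure.pi fun _ : ι => μ)

omit [MeasurableSpace K] [BorelSpace K] in
/-- `y ↦ x ⬝ᵥ y` is continuous. [cite: WeilBNT1967, Ch. II §5, Prop. 12] -/
theorem continuous_dotProduct_right (x : ι → K) : Continuous fun y : ι → K => x ⬝ᵥ y :=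
  continuous_finsetSum _ fun i _ => continuous_const.mul (continuous_apply i)

/-- the slab indicator `y ↦ 𝟙_{b+𝔭^r}(x ⬝ᵥ y)` is measurable. [cite: Weil1965, Chap. V n° 49 Lemma 22, p. 70] -/
theorem measurable_slabIndicator (x : ι → K) (b : K) (r : ℤ) :
    Measurable fun y : ι → K => (b +ᵥ primePowBall K r).indicator (1 : K → ℂ) (x ⬝ᵥ y) := by
  haveI : SecondCountableTopology K := secondCountable
  have h : (fun y : ι → K => (b +ᵥ primePowBall K r).indicator (1 : K → ℂ) (x ⬝ᵥ y)) =
      ((fun y : ι → K => x ⬝ᵥ y) ⁻¹' (b +ᵥ primePowBall K r)).indicator (fun _ => (1 : ℂ)) := by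
    funext y
    by_cases hy : x ⬝ᵥ y ∈ b +ᵥ primePowBall K r
    · rw [Set.indicator_of_mem hy, Set.indicator_of_mem (show y ∈ _ from hy)]; rfl
    · rw [Set.indicator_of_notMem hy, Set.indicator_of_notMem (show y ∉ _ from hy)]
  rw [h]
  exact measurable_const.indicator
    ((measurableSet_vadd_primePowBall r b).preimage (continuous_dotProduct_right x).measurable)

omit [MeasurableSpace K] [BorelSpace K] in
/-- the slab integrand is dominated by `|f|`. [cite: Weil1965, Chap. V n° 49 Lemma 22, p. 70] -/
theorem norm_slabIndicator_mul_le (x : ι → K) (f : (ι → K) → ℂ) (b : K) (r : ℤ) (y : ι → K) :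
    ‖(b +ᵥ primePowBall K r).indicator (1 : K → ℂ) (x ⬝ᵥ y) * f y‖ ≤ ‖f y‖ := by
  rw [norm_mul]
  refine mul_le_of_le_one_left (norm_nonneg _) ?_
  by_cases hy : x ⬝ᵥ y ∈ b +ᵥ primePowBall K r
  · rw [Set.indicator_of_mem hy, Pi.one_apply, norm_one]
  · rw [Set.indicator_of_notMem hy, norm_zero]; exact zero_le_one

omit [μ.IsAddHaarMeasure] in
/-- the slab integrand is integrable for integrable `f`. [cite: Weil1965, Chap. V n° 49 Lemma 22, p. 70] -/
theorem integrable_slabIndicator_mul (x : ι → K) {f : (ι → K) → ℂ} (hf : Integrable f (Measure.pi fun _ : ι => μ))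
    (b : K) (r : ℤ) :
    Integrable (fun y => (b +ᵥ primePowBall K r).indicator (1 : K → ℂ) (x ⬝ᵥ y) * f y)
      (Measure.pi fun _ : ι => μ) :=
  hf.norm.mono' ((measurable_slabIndicator x b r).aestronglyMeasurable.mul hf.1)
    (Eventually.of_forall (norm_slabIndicator_mul_le x f b r))

omit [BorelSpace K] [μ.IsAddHaarMeasure] in
/-- `|S_r(x, f; b)| ≤ ∫ |f|`. [cite: Weil1965, Chap. V n° 49 Lemma 22, p. 70] -/
theorem norm_sliceIntegral_le (x : ι → K) {f : (ι → K) → ℂ} (hf : Integrable f (Measure.pi fun _ : ι => μ))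
    (b : K) (r : ℤ) :
    ‖sliceIntegral μ x f b r‖ ≤ ∫ y, ‖f y‖ ∂(Measure.pi fun _ : ι => μ) := by
  unfold sliceIntegral
  exact (norm_integral_le_integral_norm _).trans
    (integral_mono_of_nonneg (Eventually.of_forall fun _ => norm_nonneg _) hf.norm
      (Eventually.of_forall (norm_slabIndicator_mul_le x f b r)))

/-- **translation along the fibration**: for `f` invariant under `(𝔭^ℓ)^ι`, `x` of level `k` and `b' ∈ b + 𝔭^{ℓ+k}`,
`S_r(x, f; b') = S_r(x, f; b)` — translate `y` by `w₀ ∈ (𝔭^ℓ)^ι` with `x ⬝ᵥ w₀ = b' - b`.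
[cite: Weil1965, Chap. V n° 49 Lemma 22, p. 70] -/
theorem sliceIntegral_eq_of_mem_vadd [DecidableEq ι] {x : ι → K} {k ℓ : ℤ}
    (hx : x ∈ piPrimePowBall K ι k \ piPrimePowBall K ι (k + 1)) {f : (ι → K) → ℂ}
    (hf : ∀ y, ∀ t ∈ piPrimePowBall K ι ℓ, f (y + t) = f y) {b b' : K} (hb' : b' ∈ b +ᵥ primePowBall K (ℓ + k))
    (r : ℤ) : sliceIntegral μ x f b' r = sliceIntegral μ x f b r := by
  haveI : SecondCountableTopology K := secondCountable
  haveI := sigmaFinite_haar μ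
  obtain ⟨w₀, hw₀, hxw₀⟩ := exists_dotProduct_eq_of_mem_shell (ℓ := ℓ) hx (mem_vadd_primePowBall_iff.1 hb')
  unfold sliceIntegral
  rw [← integral_add_left_eq_self _ w₀]
  refine integral_congr_ae (Eventually.of_forall fun y => ?_)
  simp only
  rw [dotProduct_add, hxw₀, add_comm w₀ y, hf y w₀ hw₀]
  congr 1
  by_cases hy : x ⬝ᵥ y ∈ b +ᵥ primePowBall K r
  · have hy' : b' - b + x ⬝ᵥ y ∈ b' +ᵥ primePowBall K r := by
      rw [mem_vadd_primePowBall_iff] at hy ⊢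
      have e : b' - b + x ⬝ᵥ y - b' = x ⬝ᵥ y - b := by ring
      rwa [e]
    rw [Set.indicator_of_mem hy, Set.indicator_of_mem hy']; rfl
  · have hy' : b' - b + x ⬝ᵥ y ∉ b' +ᵥ primePowBall K r := by
      rw [mem_vadd_primePowBall_iff] at hy ⊢
      have e : b' - b + x ⬝ᵥ y - b' = x ⬝ᵥ y - b := by ring
      rwa [e]
    rw [Set.indicator_of_notMem hy, Set.indicator_of_notMem hy']

/-- **Fubini over the base**: `∫ 𝟙_{b+𝔭^m}(b') S_r(x, f; b') dμ(b') = μ(𝔭^r) · S_m(x, f; b)` for `r ≥ m` and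
integrable `f` (the base integral `integral_indicator_mul_indicator_vadd` inside the `y`-integral).
[cite: Weil1965, Chap. V n° 49 Lemma 22, p. 70] -/
theorem integral_indicator_mul_sliceIntegral {m r : ℤ} (hr : m ≤ r) (x : ι → K) {f : (ι → K) → ℂ}
    (hf : Integrable f (Measure.pi fun _ : ι => μ)) (b : K) :
    ∫ b', (b +ᵥ primePowBall K m).indicator (1 : K → ℂ) b' * sliceIntegral μ x f b' r ∂μ =
      (μ.real (primePowBall K r) : ℂ) * sliceIntegral μ x f b m := by
  haveI : SecondCountableTopology K := secondCountable
  haveI := sigmaFinite_haar μ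
  -- the joint integrand and its integrability
  set H : K × (ι → K) → ℂ := fun p =>
    (b +ᵥ primePowBall K m).indicator (1 : K → ℂ) p.1 *
      ((p.1 +ᵥ primePowBall K r).indicator (1 : K → ℂ) (x ⬝ᵥ p.2) * f p.2) with hH
  have hmeas2 : Measurable fun p : K × (ι → K) => (p.1 +ᵥ primePowBall K r).indicator (1 : K → ℂ) (x ⬝ᵥ p.2) := by
    have h : (fun p : K × (ι → K) => (p.1 +ᵥ primePowBall K r).indicator (1 : K → ℂ) (x ⬝ᵥ p.2)) =
        ((fun p : K × (ι → K) => x ⬝ᵥ p.2 - p.1) ⁻¹' primePowBall K r).indicator (fun _ => (1 : ℂ)) := by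
      funext p
      by_cases hp : x ⬝ᵥ p.2 ∈ p.1 +ᵥ primePowBall K r
      · rw [Set.indicator_of_mem hp, Set.indicator_of_mem (show p ∈ _ from mem_vadd_primePowBall_iff.1 hp)]; rfl
      · rw [Set.indicator_of_notMem hp,
          Set.indicator_of_notMem (show p ∉ _ from fun h => hp (mem_vadd_primePowBall_iff.2 h))]
    rw [h]
    exact measurable_const.indicator ((measurableSet_primePowBall r).preimage
      (((continuous_dotProduct_right x).comp continuous_snd).sub continuous_fst).measurable)
  have hHi : Integrable H (μ.prod (Measure.pi fun _ : ι => μ)) := by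
    have hg : Integrable (fun p : K × (ι → K) =>
        (b +ᵥ primePowBall K m).indicator (1 : K → ℂ) p.1 * f p.2) (μ.prod (Measure.pi fun _ : ι => μ)) :=
      Integrable.mul_prod ((integrable_indicator_iff (measurableSet_vadd_primePowBall m b)).2
        ((integrableOn_const_iff (C := (1 : ℂ))).2 (Or.inr (by
          rw [measure_vadd]; exact measure_primePowBall_lt_top μ m)))) hf
    refine hg.norm.mono' ?_ (Eventually.of_forall fun p => ?_)
    · exact ((measurable_const.indicator (measurableSet_vadd_primePowBall m b)).comp measurable_fst
        |>.aestronglyMeasurable.mul (hmeas2.aestronglyMeasurable.mul (hf.1.comp_snd)))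
    · rw [hH]
      simp only [norm_mul]
      refine mul_le_mul_of_nonneg_left ?_ (norm_nonneg _)
      refine mul_le_of_le_one_left (norm_nonneg _) ?_
      by_cases hp : x ⬝ᵥ p.2 ∈ p.1 +ᵥ primePowBall K r
      · rw [Set.indicator_of_mem hp, Pi.one_apply, norm_one]
      · rw [Set.indicator_of_notMem hp, norm_zero]; exact zero_le_one
  -- rewrite the left-hand side as an iterated integral of `H` and swap
  have hL : ∫ b', (b +ᵥ primePowBall K m).indicator (1 : K → ℂ) b' * sliceIntegral μ x f b' r ∂μ =
      ∫ b', ∫ y, H (b', y) ∂(Measure.pi fun _ : ι => μ) ∂μ := by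
    refine integral_congr_ae (Eventually.of_forall fun b' => ?_)
    simp only [hH, sliceIntegral]
    rw [← integral_const_mul]
  rw [hL, integral_integral_swap hHi]
  -- compute the inner (base) integral
  have hinner : ∀ y, ∫ b', H (b', y) ∂μ =
      (μ.real (primePowBall K r) : ℂ) * ((b +ᵥ primePowBall K m).indicator (1 : K → ℂ) (x ⬝ᵥ y) * f y) := by
    intro y
    simp only [hH]
    have e : (fun b' => (b +ᵥ primePowBall K m).indicator (1 : K → ℂ) b' *
        ((b' +ᵥ primePowBall K r).indicator (1 : K → ℂ) (x ⬝ᵥ y) * f y)) = fun b' =>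
        ((b +ᵥ primePowBall K m).indicator (1 : K → ℂ) b' *
          (b' +ᵥ primePowBall K r).indicator (1 : K → ℂ) (x ⬝ᵥ y)) * f y := by
      funext b'; ring
    rw [e, integral_mul_const, integral_indicator_mul_indicator_vadd μ hr b (x ⬝ᵥ y), mul_assoc]
  simp_rw [hinner]
  rw [integral_const_mul]
  rfl

/-- **THE PLATEAU LEMMA** (exactness of coarse averaging along `y ↦ x ⬝ᵥ y`): for `f` integrable and invariant under
`(𝔭^ℓ)^ι`, `x` of level `k` and `r ≥ ℓ + k`,
`μ(𝔭^r)⁻¹ S_r(x, f; b) = μ(𝔭^{ℓ+k})⁻¹ S_{ℓ+k}(x, f; b)`.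
Proof: `S_r(x, f; ·)` is constant on `b + 𝔭^{ℓ+k}` (translation), so the base integral of the Fubini identity is
`μ(𝔭^{ℓ+k}) S_r(x, f; b)`; no coset counting. [cite: Weil1965, Chap. V n° 49 Lemma 22, p. 70] -/
theorem sliceIntegral_plateau [DecidableEq ι] {x : ι → K} {k ℓ : ℤ}
    (hx : x ∈ piPrimePowBall K ι k \ piPrimePowBall K ι (k + 1)) {f : (ι → K) → ℂ}
    (hf : ∀ y, ∀ t ∈ piPrimePowBall K ι ℓ, f (y + t) = f y) (hfi : Integrable f (Measure.pi fun _ : ι => μ))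
    {r : ℤ} (hr : ℓ + k ≤ r) (b : K) :
    (μ.real (primePowBall K r) : ℂ)⁻¹ * sliceIntegral μ x f b r =
      (μ.real (primePowBall K (ℓ + k)) : ℂ)⁻¹ * sliceIntegral μ x f b (ℓ + k) := by
  have hFub := integral_indicator_mul_sliceIntegral μ hr x hfi b
  -- the base integrand is constant on `b + 𝔭^{ℓ+k}`
  have hconst : (fun b' => (b +ᵥ primePowBall K (ℓ + k)).indicator (1 : K → ℂ) b' * sliceIntegral μ x f b' r) =
      (b +ᵥ primePowBall K (ℓ + k)).indicator (fun _ => sliceIntegral μ x f b r) := by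
    funext b'
    by_cases hb' : b' ∈ b +ᵥ primePowBall K (ℓ + k)
    · rw [Set.indicator_of_mem hb', Set.indicator_of_mem hb', Pi.one_apply, one_mul,
        sliceIntegral_eq_of_mem_vadd μ hx hf hb']
    · rw [Set.indicator_of_notMem hb', Set.indicator_of_notMem hb', zero_mul]
  rw [hconst, integral_indicator_const _ (measurableSet_vadd_primePowBall _ b), measureReal_def, measure_vadd,
    ← measureReal_def, Complex.real_smul] at hFub
  have h1 : (μ.real (primePowBall K r) : ℂ) ≠ 0 :=
    Complex.ofReal_ne_zero.2 (measureReal_primePowBall_pos μ r).ne'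
  have h2 : (μ.real (primePowBall K (ℓ + k)) : ℂ) ≠ 0 :=
    Complex.ofReal_ne_zero.2 (measureReal_primePowBall_pos μ (ℓ + k)).ne'
  field_simp
  linear_combination hFub

end Slab

/-! ## §2 The slice density (density at `b` of the image of `f dy` under `y ↦ x ⬝ᵥ y`) -/

section SliceDensity

variable [Fintype ι] [MeasurableSpace K] [BorelSpace K] (μ : Measure K) [μ.IsAddHaarMeasure]

/-- **the slice density** `s(x, f; b) := lim_{r → ∞} μ(𝔭^r)⁻¹ S_r(x, f; b)` — for `x ≠ 0` and `f` Schwartz–Bruhat the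
averages are eventually constant (`sliceIntegral_plateau`), so this is the plateau value: the density at `b`, with
respect to `μ`, of the image of the measure `f(y) dμ^ι(y)` under the linear fibration `y ↦ x ⬝ᵥ y`.
[cite: Weil1965, Chap. IV n° 44 Thm 2, p. 63] -/
def sliceDensity (x : ι → K) (f : (ι → K) → ℂ) (b : K) : ℂ :=
  limUnder atTop fun r : ℤ => (μ.real (primePowBall K r) : ℂ)⁻¹ * sliceIntegral μ x f b r

/-- the averages are EVENTUALLY CONSTANT, equal to the plateau value at `r = ℓ + k`. [cite: Weil1965, Chap. IV n° 44 Thm 2, p. 63] -/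
theorem eventuallyEq_sliceAvg [DecidableEq ι] {x : ι → K} {k ℓ : ℤ}
    (hx : x ∈ piPrimePowBall K ι k \ piPrimePowBall K ι (k + 1)) {f : (ι → K) → ℂ}
    (hf : ∀ y, ∀ t ∈ piPrimePowBall K ι ℓ, f (y + t) = f y) (hfi : Integrable f (Measure.pi fun _ : ι => μ)) (b : K) :
    (fun r : ℤ => (μ.real (primePowBall K r) : ℂ)⁻¹ * sliceIntegral μ x f b r) =ᶠ[atTop]
      fun _ => (μ.real (primePowBall K (ℓ + k)) : ℂ)⁻¹ * sliceIntegral μ x f b (ℓ + k) :=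
  (eventually_ge_atTop (ℓ + k)).mono fun _ hr => sliceIntegral_plateau μ hx hf hfi hr b

/-- **convergence of the slab averages** to the slice density. [cite: Weil1965, Chap. IV n° 44 Thm 2, p. 63] -/
theorem tendsto_sliceAvg [DecidableEq ι] {x : ι → K} {k ℓ : ℤ}
    (hx : x ∈ piPrimePowBall K ι k \ piPrimePowBall K ι (k + 1)) {f : (ι → K) → ℂ}
    (hf : ∀ y, ∀ t ∈ piPrimePowBall K ι ℓ, f (y + t) = f y) (hfi : Integrable f (Measure.pi fun _ : ι => μ)) (b : K) :
    Tendsto (fun r : ℤ => (μ.real (primePowBall K r) : ℂ)⁻¹ * sliceIntegral μ x f b r) atTop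
      (𝓝 (sliceDensity μ x f b)) := by
  have h : Tendsto (fun r : ℤ => (μ.real (primePowBall K r) : ℂ)⁻¹ * sliceIntegral μ x f b r) atTop
      (𝓝 ((μ.real (primePowBall K (ℓ + k)) : ℂ)⁻¹ * sliceIntegral μ x f b (ℓ + k))) :=
    Tendsto.congr' (eventuallyEq_sliceAvg μ hx hf hfi b).symm tendsto_const_nhds
  rwa [sliceDensity, h.limUnder_eq]

/-- **the slice density is the plateau value**: `s(x, f; b) = μ(𝔭^{ℓ+k})⁻¹ S_{ℓ+k}(x, f; b)` for `f` invariant under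
`(𝔭^ℓ)^ι` and `x` of level `k` (any admissible `ℓ` gives the same value). [cite: Weil1965, Chap. IV n° 44 Thm 2, p. 63] -/
theorem sliceDensity_eq [DecidableEq ι] {x : ι → K} {k ℓ : ℤ}
    (hx : x ∈ piPrimePowBall K ι k \ piPrimePowBall K ι (k + 1)) {f : (ι → K) → ℂ}
    (hf : ∀ y, ∀ t ∈ piPrimePowBall K ι ℓ, f (y + t) = f y) (hfi : Integrable f (Measure.pi fun _ : ι => μ)) (b : K) :
    sliceDensity μ x f b = (μ.real (primePowBall K (ℓ + k)) : ℂ)⁻¹ * sliceIntegral μ x f b (ℓ + k) := by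
  have h : Tendsto (fun r : ℤ => (μ.real (primePowBall K r) : ℂ)⁻¹ * sliceIntegral μ x f b r) atTop
      (𝓝 ((μ.real (primePowBall K (ℓ + k)) : ℂ)⁻¹ * sliceIntegral μ x f b (ℓ + k))) :=
    Tendsto.congr' (eventuallyEq_sliceAvg μ hx hf hfi b).symm tendsto_const_nhds
  rw [sliceDensity, h.limUnder_eq]

/-- **the slice density is locally constant in `b`**: constant on the cosets of `𝔭^{ℓ+k}`.
[cite: Weil1965, Chap. III n° 37 Prop. 6, p. 54] -/
theorem sliceDensity_eq_of_mem_vadd [DecidableEq ι] {x : ι → K} {k ℓ : ℤ}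
    (hx : x ∈ piPrimePowBall K ι k \ piPrimePowBall K ι (k + 1)) {f : (ι → K) → ℂ}
    (hf : ∀ y, ∀ t ∈ piPrimePowBall K ι ℓ, f (y + t) = f y) (hfi : Integrable f (Measure.pi fun _ : ι => μ))
    {b b' : K} (hb' : b' ∈ b +ᵥ primePowBall K (ℓ + k)) :
    sliceDensity μ x f b' = sliceDensity μ x f b := by
  rw [sliceDensity_eq μ hx hf hfi, sliceDensity_eq μ hx hf hfi, sliceIntegral_eq_of_mem_vadd μ hx hf hb']

/-- **uniform bound on the slab averages**: `|μ(𝔭^r)⁻¹ S_r(x, f; b)| ≤ μ(𝔭^{ℓ+k})⁻¹ ∫ |f|` for ALL `r`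
(for `r ≥ ℓ + k` by the plateau; for `r ≤ ℓ + k` because `μ(𝔭^r) ≥ μ(𝔭^{ℓ+k})`).
[cite: Weil1965, Chap. V n° 48 Lemma 21, p. 68] -/
theorem norm_sliceAvg_le [DecidableEq ι] {x : ι → K} {k ℓ : ℤ}
    (hx : x ∈ piPrimePowBall K ι k \ piPrimePowBall K ι (k + 1)) {f : (ι → K) → ℂ}
    (hf : ∀ y, ∀ t ∈ piPrimePowBall K ι ℓ, f (y + t) = f y) (hfi : Integrable f (Measure.pi fun _ : ι => μ))
    (b : K) (r : ℤ) :
    ‖(μ.real (primePowBall K r) : ℂ)⁻¹ * sliceIntegral μ x f b r‖ ≤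
      (μ.real (primePowBall K (ℓ + k)))⁻¹ * ∫ y, ‖f y‖ ∂(Measure.pi fun _ : ι => μ) := by
  have hpos : ∀ n : ℤ, 0 < μ.real (primePowBall K n) := measureReal_primePowBall_pos μ
  have key : ∀ n : ℤ, μ.real (primePowBall K (ℓ + k)) ≤ μ.real (primePowBall K n) →
      ‖(μ.real (primePowBall K n) : ℂ)⁻¹ * sliceIntegral μ x f b n‖ ≤
        (μ.real (primePowBall K (ℓ + k)))⁻¹ * ∫ y, ‖f y‖ ∂(Measure.pi fun _ : ι => μ) := by
    intro n hn
    rw [norm_mul, norm_inv, Complex.norm_real, Real.norm_of_nonneg (hpos n).le]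
    exact mul_le_mul (inv_anti₀ (hpos _) hn) (norm_sliceIntegral_le μ x hfi b n) (norm_nonneg _)
      (inv_nonneg.2 (hpos _).le)
  by_cases hr : ℓ + k ≤ r
  · rw [sliceIntegral_plateau μ hx hf hfi hr b]
    exact key _ le_rfl
  · exact key r (measureReal_mono (primePowBall_antitone (le_of_not_ge hr))
      (measure_primePowBall_lt_top μ _).ne)

/-- the slice density obeys the same bound. [cite: Weil1965, Chap. V n° 48 Lemma 21, p. 68] -/
theorem norm_sliceDensity_le [DecidableEq ι] {x : ι → K} {k ℓ : ℤ}
    (hx : x ∈ piPrimePowBall K ι k \ piPrimePowBall K ι (k + 1)) {f : (ι → K) → ℂ}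
    (hf : ∀ y, ∀ t ∈ piPrimePowBall K ι ℓ, f (y + t) = f y) (hfi : Integrable f (Measure.pi fun _ : ι => μ))
    (b : K) :
    ‖sliceDensity μ x f b‖ ≤ (μ.real (primePowBall K (ℓ + k)))⁻¹ * ∫ y, ‖f y‖ ∂(Measure.pi fun _ : ι => μ) := by
  rw [sliceDensity_eq μ hx hf hfi]
  exact norm_sliceAvg_le μ hx hf hfi b (ℓ + k)

omit [BorelSpace K] [μ.IsAddHaarMeasure] in
/-- the slab integral vanishes when `f = 0`; hence so do the averages and the density (used at `x` off the support).
[cite: Weil1965, Chap. V n° 49 Lemma 22, p. 70] -/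
theorem sliceIntegral_zero_fun (x : ι → K) (b : K) (r : ℤ) : sliceIntegral μ x (fun _ => 0) b r = 0 := by
  simp [sliceIntegral]

omit [BorelSpace K] [μ.IsAddHaarMeasure] in
/-- the slice density of the zero function is `0`. [cite: Weil1965, Chap. V n° 49 Lemma 22, p. 70] -/
theorem sliceDensity_zero_fun (x : ι → K) (b : K) : sliceDensity μ x (fun _ => 0) b = 0 := by
  have h : Tendsto (fun r : ℤ => (μ.real (primePowBall K r) : ℂ)⁻¹ * sliceIntegral μ x (fun _ => 0) b r) atTop
      (𝓝 0) := by
    simp_rw [sliceIntegral_zero_fun, mul_zero]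
    exact tendsto_const_nhds
  rw [sliceDensity, h.limUnder_eq]

end SliceDensity

/-! ## §3 Levels as a function, shells of boxes, and the integrability of `x ↦ μ(𝔭^{ℓ + level x})⁻¹` near `0` -/

section LevelFun

variable [Fintype ι]

/-- the LEVEL of `x ∈ K^ι`: the unique `k` with `x ∈ (𝔭^k)^ι ∖ (𝔭^{k+1})^ι` (`maxᵢ ‖xᵢ‖ = (q⁻¹)^k`); `0` at `x = 0`
(a junk value on a null set). [cite: WeilBNT1967, Ch. II §2, Def. 2] -/
def level [Nonempty ι] (x : ι → K) : ℤ :=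
  haveI := Classical.dec (x = 0)
  if h : x = 0 then 0 else Classical.choose (exists_mem_shell_of_ne_zero h)

/-- `x ≠ 0` lies in the shell of its level. [cite: WeilBNT1967, Ch. II §2, Def. 2] -/
theorem mem_shell_level [Nonempty ι] {x : ι → K} (hx : x ≠ 0) :
    x ∈ piPrimePowBall K ι (level x) \ piPrimePowBall K ι (level x + 1) := by
  classical
  rw [level, dif_neg hx]
  exact Classical.choose_spec (exists_mem_shell_of_ne_zero hx)

/-- the level of a point of the shell `(𝔭^k)^ι ∖ (𝔭^{k+1})^ι` is `k`. [cite: WeilBNT1967, Ch. II §2, Def. 2] -/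
theorem level_eq_of_mem_shell [Nonempty ι] {x : ι → K} {k : ℤ}
    (hx : x ∈ piPrimePowBall K ι k \ piPrimePowBall K ι (k + 1)) : level x = k := by
  have hx0 : x ≠ 0 := by
    rintro rfl
    exact hx.2 (zero_mem_piPrimePowBall _)
  exact eq_of_mem_shell_of_mem_shell (mem_shell_level hx0) hx

/-- `0` lies in every box. [cite: WeilBNT1967, Ch. II §2, Def. 2] -/
theorem level_zero [Nonempty ι] : level (0 : ι → K) = 0 := by
  classical
  rw [level, dif_pos rfl]

/-- a point of the box `(𝔭^n)^ι` has level `≥ n`. [cite: WeilBNT1967, Ch. II §2, Def. 2] -/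
theorem le_level_of_mem [Nonempty ι] {x : ι → K} (hx : x ≠ 0) {n : ℤ} (hn : x ∈ piPrimePowBall K ι n) :
    n ≤ level x := by
  by_contra h
  exact (mem_shell_level hx).2 (piPrimePowBall_antitone (by omega) hn)

/-- the fibre `{level = k}` off `0` is the shell. [cite: WeilBNT1967, Ch. II §2, Def. 2] -/
theorem level_eq_iff [Nonempty ι] {x : ι → K} (hx : x ≠ 0) {k : ℤ} :
    level x = k ↔ x ∈ piPrimePowBall K ι k \ piPrimePowBall K ι (k + 1) :=
  ⟨fun h => h ▸ mem_shell_level hx, level_eq_of_mem_shell⟩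

variable [MeasurableSpace K] [BorelSpace K]

/-- boxes are measurable (product `σ`-algebra). [cite: WeilBNT1967, Ch. I §2, Th. 3 Cor. 3] -/
theorem measurableSet_piPrimePowBall' (n : ℤ) : MeasurableSet (piPrimePowBall K ι n) :=
  MeasurableSet.univ_pi fun _ => measurableSet_primePowBall n

/-- **the level function is measurable** (its fibres are shells, up to the null point `0`). [cite: WeilBNT1967, Ch. II §2, Def. 2] -/
theorem measurable_level [Nonempty ι] [MeasurableSingletonClass K] : Measurable (level : (ι → K) → ℤ) := by
  refine measurable_to_countable' fun k => ?_
  have h : (level : (ι → K) → ℤ) ⁻¹' {k} =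
      (piPrimePowBall K ι k \ piPrimePowBall K ι (k + 1)) ∪ (if k = 0 then {0} else ∅) := by
    ext x
    simp only [Set.mem_preimage, Set.mem_singleton_iff, Set.mem_union]
    by_cases hx : x = 0
    · subst hx
      rw [level_zero]
      constructor
      · intro h; right; rw [if_pos h.symm]; exact Set.mem_singleton _
      · rintro (h | h)
        · exact absurd (zero_mem_piPrimePowBall (k + 1)) h.2
        · by_cases hk : k = 0
          · exact hk.symm
          · rw [if_neg hk] at h; exact h.elim
    · rw [level_eq_iff hx]
      constructor
      · intro h; left; exact h
      · rintro (h | h)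
        · exact h
        · by_cases hk : k = 0
          · rw [if_pos hk] at h; exact absurd h hx
          · rw [if_neg hk] at h; exact h.elim
  rw [h]
  refine ((measurableSet_piPrimePowBall' k).diff (measurableSet_piPrimePowBall' (k + 1))).union ?_
  split_ifs
  · exact MeasurableSet.singleton 0
  · exact MeasurableSet.empty

omit [MeasurableSpace K] [BorelSpace K] in
/-- a box is covered by `{0}` and the shells `(𝔭^{n+i})^ι ∖ (𝔭^{n+i+1})^ι`, `i ∈ ℕ`. [cite: WeilBNT1967, Ch. II §2, Def. 2] -/
theorem piPrimePowBall_subset_union_shells [Nonempty ι] (n : ℤ) :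
    piPrimePowBall K ι n ⊆ {0} ∪ ⋃ i : ℕ, (piPrimePowBall K ι (n + i) \ piPrimePowBall K ι (n + i + 1)) := by
  intro x hx
  by_cases hx0 : x = 0
  · exact Or.inl hx0
  · refine Or.inr (Set.mem_iUnion.2 ⟨(level x - n).toNat, ?_⟩)
    have hle := le_level_of_mem hx0 hx
    have e : n + ((level x - n).toNat : ℤ) = level x := by omega
    rw [e]
    exact mem_shell_level hx0

variable (μ : Measure K) [μ.IsAddHaarMeasure]

/-- **the level weight** `w_ℓ(x) = μ(𝔭^{ℓ + level x})⁻¹` — the uniform bound of the slab averages of a function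
invariant under `(𝔭^ℓ)^ι` at the point `x` (`norm_sliceAvg_le`). [cite: Weil1965, Chap. V n° 48 Lemma 21, p. 68] -/
def levelWeight [Nonempty ι] (ℓ : ℤ) (x : ι → K) : ℝ :=
  (μ.real (primePowBall K (ℓ + level x)))⁻¹

omit [BorelSpace K] in
/-- the level weight is positive. [cite: WeilBNT1967, Ch. II §2, Def. 2] -/
theorem levelWeight_pos [Nonempty ι] (ℓ : ℤ) (x : ι → K) : 0 < levelWeight μ ℓ x :=
  inv_pos.2 (measureReal_primePowBall_pos μ _)

/-- on the shell of level `k` the weight is the constant `(q⁻¹)^{-(ℓ+k)} μ(𝒪)⁻¹`. [cite: WeilBNT1967, Ch. II §2, Def. 2] -/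
theorem levelWeight_eq_of_mem_shell [Nonempty ι] (ℓ : ℤ) {k : ℤ} {x : ι → K}
    (hx : x ∈ piPrimePowBall K ι k \ piPrimePowBall K ι (k + 1)) :
    levelWeight μ ℓ x = (((residueFieldCard K : ℝ)⁻¹) ^ (ℓ + k))⁻¹ * (μ.real (primePowBall K 0))⁻¹ := by
  rw [levelWeight, level_eq_of_mem_shell hx, measureReal_primePowBall μ (ℓ + k), mul_inv]

omit [μ.IsAddHaarMeasure] in
/-- the level weight is measurable. [cite: WeilBNT1967, Ch. II §2, Def. 2] -/
theorem measurable_levelWeight [Nonempty ι] [MeasurableSingletonClass K] (ℓ : ℤ) :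
    Measurable (levelWeight μ ℓ : (ι → K) → ℝ) :=
  (measurable_of_countable fun k : ℤ => (μ.real (primePowBall K (ℓ + k)))⁻¹).comp measurable_level

omit [BorelSpace K] in
/-- instance helper: a Haar measure on `K` is `σ`-finite. [folklore] -/
private theorem sigmaFinite_haar' : SigmaFinite μ := by
  haveI : T2Space K :=
    (Literature.NumberTheory.GaloisRepresentations.IsNonarchimedeanLocalField.isLocalField K).toT2Space
  haveI : LocallyCompactSpace K :=
    (Literature.NumberTheory.GaloisRepresentations.IsNonarchimedeanLocalField.isLocalField K).toLocallyCompactSpace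
  haveI : SecondCountableTopology K := secondCountableTopology_localField K
  infer_instance

/-- **measure of a box**: `μ^ι((𝔭^m)^ι) = ((q⁻¹)^m μ(𝒪))^{|ι|}`. [cite: WeilBNT1967, Ch. II §2, Def. 2] -/
theorem measure_pi_piPrimePowBall (m : ℤ) :
    Measure.pi (fun _ : ι => μ) (piPrimePowBall K ι m) =
      ENNReal.ofReal (((residueFieldCard K : ℝ)⁻¹) ^ m * μ.real (primePowBall K 0)) ^ Fintype.card ι := by
  haveI := sigmaFinite_haar' μ
  rw [piPrimePowBall, Measure.pi_pi, Finset.prod_const, Finset.card_univ, ← measureReal_primePowBall μ m,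
    measureReal_def, ENNReal.ofReal_toReal (measure_primePowBall_lt_top μ m).ne]

/-- boxes have finite `μ^ι`-measure. [cite: WeilBNT1967, Ch. I §2, Th. 3 Cor. 3] -/
theorem measure_pi_piPrimePowBall_lt_top (m : ℤ) : Measure.pi (fun _ : ι => μ) (piPrimePowBall K ι m) < ⊤ := by
  rw [measure_pi_piPrimePowBall]
  exact ENNReal.pow_lt_top ENNReal.ofReal_lt_top

/-- the origin is `μ^ι`-null (`ι` non-empty). [cite: WeilBNT1967, Ch. I §2, Th. 3 Cor. 3] -/
theorem measure_pi_singleton_zero [Nonempty ι] : Measure.pi (fun _ : ι => μ) ({0} : Set (ι → K)) = 0 := by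
  haveI := sigmaFinite_haar' μ
  obtain ⟨i⟩ := ‹Nonempty ι›
  rw [Measure.pi_singleton]
  exact Finset.prod_eq_zero (Finset.mem_univ i) (by simpa using measure_singleton_zero μ)

/-- ball measures along the filtration: `μ(𝔭^{j+m}) = (q⁻¹)^j μ(𝔭^m)`. [cite: WeilBNT1967, Ch. I §2, Th. 3 Cor. 3] -/
theorem measureReal_primePowBall_add (j m : ℤ) :
    μ.real (primePowBall K (j + m)) = ((residueFieldCard K : ℝ)⁻¹) ^ j * μ.real (primePowBall K m) := by
  have hq0 : ((residueFieldCard K : ℝ)⁻¹) ≠ 0 :=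
    inv_ne_zero (Nat.cast_ne_zero.2 (residueFieldCard_ne_zero K))
  rw [measureReal_primePowBall μ (j + m), measureReal_primePowBall μ m, zpow_add₀ hq0, mul_assoc]

/-- **INTEGRABILITY OF THE LEVEL WEIGHT NEAR `0` for `|ι| ≥ 2`**: `∫_{(𝔭^n)^ι} μ(𝔭^{ℓ + level x})⁻¹ dμ^ι(x) < ∞` — on the
shell of level `k` the weight is `≍ q^k` and the shell has measure `≍ q^{-k|ι|}`, a convergent geometric series iff
`|ι| ≥ 2`. This is the integrability of `x ↦ ‖x‖⁻¹` on `K^ι` near the origin, i.e. the fact that the cone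
`{x ⬝ᵥ y = 0}` has finite fibre density: Weil's condition for the continuity of the singular fibre integral at `0`.
[cite: Weil1965, Chap. III n° 37 Prop. 6, p. 54] -/
theorem integrableOn_levelWeight [Nonempty ι] [MeasurableSingletonClass K] (hι : 2 ≤ Fintype.card ι) (ℓ n : ℤ) :
    IntegrableOn (levelWeight μ ℓ) (piPrimePowBall K ι n) (Measure.pi fun _ : ι => μ) := by
  haveI := sigmaFinite_haar' μ
  obtain ⟨M, hM1, hM⟩ : ∃ M : ℕ, 1 ≤ M ∧ Fintype.card ι = M + 1 := ⟨Fintype.card ι - 1, by omega, by omega⟩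
  set rq : ℝ := (residueFieldCard K : ℝ)⁻¹ with hrq
  have hq1 : 1 < (residueFieldCard K : ℝ) := by exact_mod_cast one_lt_residueFieldCard K
  have hq0 : 0 < (residueFieldCard K : ℝ) := zero_lt_one.trans hq1
  have hrq0 : 0 < rq := inv_pos.2 hq0
  have hrq1 : rq < 1 := inv_lt_one_of_one_lt₀ hq1
  -- `a m = μ(𝔭^m)` and its two scaling rules
  set a : ℤ → ℝ := fun m => μ.real (primePowBall K m) with ha
  have hapos : ∀ m, 0 < a m := fun m => measureReal_primePowBall_pos μ m
  have haℓ : ∀ m, a (ℓ + m) = rq ^ ℓ * a m := fun m => measureReal_primePowBall_add μ ℓ m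
  have hai : ∀ i : ℕ, a (n + i) = rq ^ i * a n := fun i => by
    rw [ha]; simp only
    rw [add_comm, measureReal_primePowBall_add μ (i : ℤ) n, zpow_natCast]
  -- constants of the geometric bound
  set C : ℝ := (rq ^ ℓ)⁻¹ * a n ^ M with hC
  set θ : ℝ := rq ^ M with hθ
  have hθ0 : 0 ≤ θ := by positivity
  have hθ1 : θ < 1 := pow_lt_one₀ hrq0.le hrq1 (by omega)
  have hC0 : 0 ≤ C := by
    have := hapos n
    positivity
  refine ⟨(measurable_levelWeight μ ℓ).aestronglyMeasurable.restrict, ?_⟩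
  rw [hasFiniteIntegral_iff_enorm]
  -- the shells and the shell integrals
  set S : ℕ → Set (ι → K) := fun i => piPrimePowBall K ι (n + i) \ piPrimePowBall K ι (n + i + 1) with hS
  have hshell : ∀ i : ℕ, ∫⁻ x in S i, ‖levelWeight μ ℓ x‖ₑ ∂(Measure.pi fun _ : ι => μ) ≤
      ENNReal.ofReal C * ENNReal.ofReal θ ^ i := by
    intro i
    have hval : ∀ x ∈ S i, ‖levelWeight μ ℓ x‖ₑ = ENNReal.ofReal ((a (ℓ + (n + i)))⁻¹) := by
      intro x hx
      rw [Real.enorm_eq_ofReal (levelWeight_pos μ ℓ x).le, levelWeight, level_eq_of_mem_shell hx]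
    calc ∫⁻ x in S i, ‖levelWeight μ ℓ x‖ₑ ∂(Measure.pi fun _ : ι => μ)
        = ∫⁻ _ in S i, ENNReal.ofReal ((a (ℓ + (n + i)))⁻¹) ∂(Measure.pi fun _ : ι => μ) :=
          setLIntegral_congr_fun ((measurableSet_piPrimePowBall' _).diff (measurableSet_piPrimePowBall' _)) hval
      _ = ENNReal.ofReal ((a (ℓ + (n + i)))⁻¹) * Measure.pi (fun _ : ι => μ) (S i) := setLIntegral_const _ _
      _ ≤ ENNReal.ofReal ((a (ℓ + (n + i)))⁻¹) * Measure.pi (fun _ : ι => μ) (piPrimePowBall K ι (n + i)) := by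
          gcongr; exact Set.sdiff_subset
      _ = ENNReal.ofReal ((a (ℓ + (n + i)))⁻¹) * ENNReal.ofReal (a (n + i)) ^ (M + 1) := by
          rw [← hM, piPrimePowBall, Measure.pi_pi, Finset.prod_const, Finset.card_univ,
            ← ENNReal.ofReal_toReal (measure_primePowBall_lt_top μ (n + i)).ne]
          rfl
      _ = ENNReal.ofReal ((a (ℓ + (n + i)))⁻¹ * a (n + i) ^ (M + 1)) := by
          rw [← ENNReal.ofReal_pow (hapos _).le, ← ENNReal.ofReal_mul (inv_nonneg.2 (hapos _).le)]
      _ = ENNReal.ofReal (C * θ ^ i) := by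
          congr 1
          rw [haℓ, hai, hC, hθ]
          have h1 : rq ^ ℓ ≠ 0 := zpow_ne_zero ℓ hrq0.ne'
          have h2 : rq ^ i ≠ 0 := pow_ne_zero i hrq0.ne'
          have h3 : a n ≠ 0 := (hapos n).ne'
          field_simp
          ring
      _ = ENNReal.ofReal C * ENNReal.ofReal θ ^ i := by
          rw [ENNReal.ofReal_mul hC0, ENNReal.ofReal_pow hθ0]
  -- assemble: the box is covered by `{0}` and the shells
  calc ∫⁻ x, ‖levelWeight μ ℓ x‖ₑ ∂((Measure.pi fun _ : ι => μ).restrict (piPrimePowBall K ι n))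
      ≤ ∫⁻ x in {0} ∪ ⋃ i, S i, ‖levelWeight μ ℓ x‖ₑ ∂(Measure.pi fun _ : ι => μ) :=
        lintegral_mono_set (piPrimePowBall_subset_union_shells n)
    _ ≤ ∫⁻ x in ({0} : Set (ι → K)), ‖levelWeight μ ℓ x‖ₑ ∂(Measure.pi fun _ : ι => μ) +
          ∫⁻ x in ⋃ i, S i, ‖levelWeight μ ℓ x‖ₑ ∂(Measure.pi fun _ : ι => μ) := lintegral_union_le _ _ _
    _ ≤ 0 + ∑' i, ∫⁻ x in S i, ‖levelWeight μ ℓ x‖ₑ ∂(Measure.pi fun _ : ι => μ) := by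
        gcongr
        · exact (setLIntegral_measure_zero _ _ (measure_pi_singleton_zero μ)).le
        · exact lintegral_iUnion_le _ _
    _ ≤ 0 + ∑' i, ENNReal.ofReal C * ENNReal.ofReal θ ^ i := by gcongr; exact hshell _
    _ = ENNReal.ofReal C * (1 - ENNReal.ofReal θ)⁻¹ := by
        rw [zero_add, ENNReal.tsum_mul_left, ENNReal.tsum_geometric]
    _ < ⊤ := by
        refine ENNReal.mul_lt_top ENNReal.ofReal_lt_top (ENNReal.inv_lt_top.2 ?_)
        rw [tsub_pos_iff_lt, ENNReal.ofReal_lt_one]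
        exact hθ1

end LevelFun

end Literature.NumberTheory.Weil1965.SplitPlace
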